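import Mathlib
import HarnessLib
import Literature.MathematicalPhysics.QuantumFieldTheory.U1VillainMasslessPhotonD4
import Literature.MathematicalPhysics.QuantumFieldTheory.U1WardIdentity
import Literature.Probability.LatticeModels.HighDimTrivialityUniformProofs

/-!
# `WilsonU1DipoleLawD4` (crux stmt-QuantumFields-25880, route `U1DipoleHelicity`): the OBJECTS of the
# birth skeleton, and the registered stub `stub_weightSummable`

Route `U1DipoleHelicity` is LINE 4 of the ideator cell ym-idea-2 — an abelian COMPARISON line onto the node
`Theorems.U1HelicityGapD4` (Wilson `U(1)₄` masslessness), NOT a rung of `YangMills`.  Its deciding crux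
`Theses.U1DipoleHelicity.WilsonU1DipoleLawD4` (the dipole law of the weak-coupling Wilson `U(1)₄` photon with
a summable remainder; open in print, FS82 fn. 3) carries a registered birth skeleton
(`bc/WilsonU1DipoleLawD4_birth.lean`, planner ym-idea-2 g2: Villain calibration ∘ Wilson-to-Villain
comparison ∘ summability of the remainder weight).  This file lands the three route-posited objects of
that skeleton VERBATIM, so that its registered stubs can be landed by name from an importable module
(no `Theses` import: everything is in the tree's vocabulary):

* `freeK z = (2π)⁻⁴ ∫_{[-π,π]⁴} cos(k·z) (k̂₀² + k̂₁²)/k̂² dk` — the free lattice photon kernel of `F₀₁`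
  (the term inlined as a `let` in the route decls `WilsonU1DipoleLawD4` / `FreeDipoleBoxMeanHalf`);
* `weight z = (1 + |z|₁)⁻⁵` — the summable isotropic weight carrying the pointwise remainder bounds;
* `villainPlaqCorr βV n z = ⟨sin θ_{(0;0,1)} sin θ_{(z;0,1)}⟩^{Villain, free}_{box 4 n, βV}` — the
  free-boundary Villain electric two-plaquette function (tree `zdVillainExpect`, `u1PlaqIm`).

Proved here: `weight_pos`, `weight_le_one`, and the skeleton's stub 3
**`stub_weightSummable : Summable weight`** (shell counting in the sup norm: `(1 + |z|₁)⁻⁵ ≤ (1 + ‖z‖_∞)⁻⁵`,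
`#{‖z‖_∞ = k+1} ≤ 8(2k+3)³`, tree `summable_of_supNorm_bound`).

Nothing here bears on the Yang–Mills mass gap.
-/

set_option autoImplicit false

noncomputable section

namespace Summit.QuantumFields.YangMills.Theorems.U1DipoleHelicity

open MeasureTheory Finset
open Literature.Probability.LatticeModels Literature.MathematicalPhysics.QuantumFieldTheory

/-- The free lattice photon kernel of the field strength `F₀₁` at `β = 1`,
`K(z) = (2π)⁻⁴ ∫_{[-π,π]⁴} cos(k·z) · (k̂₀² + k̂₁²)/Σ_μ k̂_μ² dk`, `k̂_μ = 2 sin(k_μ/2)` — verbatim the `let K`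
of the route decls `Theses.U1DipoleHelicity.WilsonU1DipoleLawD4` / `FreeDipoleBoxMeanHalf` and the
`freeK` of the registered birth skeleton of crux stmt-QuantumFields-25880. -/
def freeK : Literature.Probability.LatticeModels.Site 4 → ℝ := fun z =>
    (1 / (2 * Real.pi) ^ 4) *
      ∫ k in Set.pi Set.univ (fun _ : Fin 4 => Set.Icc (-Real.pi) Real.pi),
        Real.cos (∑ i : Fin 4, k i * (z i : ℝ)) *
          (((2 * Real.sin (k 0 / 2)) ^ 2 + (2 * Real.sin (k 1 / 2)) ^ 2) /
            (∑ i : Fin 4, (2 * Real.sin (k i / 2)) ^ 2))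

/-- The summable isotropic weight `w(z) = (1 + |z|₁)⁻⁵` on `ℤ⁴` carrying the pointwise remainder bounds of
the dipole law (verbatim the `weight` of the registered birth skeleton of crux stmt-QuantumFields-25880). -/
def weight (z : Literature.Probability.LatticeModels.Site 4) : ℝ :=
  ((1 + ∑ i : Fin 4, |(z i : ℝ)|) ^ 5)⁻¹

/-- The Villain free-boundary electric two-plaquette function in the cube `{-n,…,n}⁴` at coupling `βV`:
`V_{βV,n}(z) = ⟨sin θ_{(0;0,1)} · sin θ_{(z;0,1)}⟩^{Villain}_{box 4 n, βV}` (same observable as the Wilson-side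
`U1Helicity.plaqCorr`; verbatim the `villainPlaqCorr` of the registered birth skeleton of crux
stmt-QuantumFields-25880). -/
def villainPlaqCorr (βV : ℝ) (n : ℕ) (z : Literature.Probability.LatticeModels.Site 4) : ℝ :=
  Literature.MathematicalPhysics.QuantumFieldTheory.zdVillainExpect (d := 4) βV
    (Literature.Probability.LatticeModels.box 4 n)
    (fun U => Literature.MathematicalPhysics.QuantumFieldTheory.u1PlaqIm 0 0 1 U *
      Literature.MathematicalPhysics.QuantumFieldTheory.u1PlaqIm z 0 1 U)

/-! ### The weight: positivity and summability (stub 3 of the skeleton) -/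

/-- `w(z) > 0`. [folklore] -/
theorem weight_pos (z : Literature.Probability.LatticeModels.Site 4) : 0 < weight z := by
  unfold weight
  positivity

/-- `w(z) ≤ 1`. [folklore] -/
theorem weight_le_one (z : Literature.Probability.LatticeModels.Site 4) : weight z ≤ 1 := by
  unfold weight
  have h : (1 : ℝ) ≤ (1 + ∑ i : Fin 4, |(z i : ℝ)|) ^ 5 :=
    one_le_pow₀ (le_add_of_nonneg_right (Finset.sum_nonneg fun i _ => abs_nonneg _))
  exact inv_le_one_of_one_le₀ h

/-- The sup norm is dominated by the `ℓ¹` norm: `‖z‖_∞ ≤ Σᵢ |zᵢ|`. [folklore] -/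
theorem supNorm_le_sum_abs (z : Literature.Probability.LatticeModels.Site 4) :
    (Site.supNorm z : ℝ) ≤ ∑ i : Fin 4, |(z i : ℝ)| := by
  have h : Site.supNorm z ≤ ∑ i : Fin 4, (z i).natAbs := by
    unfold Site.supNorm
    exact Finset.sup_le fun i _ =>
      Finset.single_le_sum (f := fun j => (z j).natAbs) (fun j _ => Nat.zero_le _) (Finset.mem_univ i)
  calc (Site.supNorm z : ℝ) ≤ ((∑ i : Fin 4, (z i).natAbs : ℕ) : ℝ) := by exact_mod_cast h
    _ = ∑ i : Fin 4, |(z i : ℝ)| := by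
        rw [Nat.cast_sum]
        exact Finset.sum_congr rfl fun i _ => by rw [Nat.cast_natAbs, Int.cast_abs]

/-- The weight is dominated by a function of the sup norm: `w(z) ≤ (1 + ‖z‖_∞)⁻⁵`. [folklore] -/
theorem weight_le_supNorm (z : Literature.Probability.LatticeModels.Site 4) :
    weight z ≤ ((1 + (Site.supNorm z : ℝ)) ^ 5)⁻¹ := by
  unfold weight
  have h0 : (0 : ℝ) < (1 + (Site.supNorm z : ℝ)) ^ 5 := by positivity
  exact inv_anti₀ h0 (pow_le_pow_left₀ (by positivity) (by linarith [supNorm_le_sum_abs z]) 5)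

/-- **Stub 3 of the registered birth skeleton of crux stmt-QuantumFields-25880 (`WilsonU1DipoleLawD4`)**:
the weight `(1 + |z|₁)⁻⁵` is summable over `ℤ⁴` (shell counting in the sup norm:
`#{‖z‖_∞ = k+1} ≤ 8(2k+3)³ ≤ 216(k+2)³`, so the shell sums are `≤ 216/(m+1)²`). [folklore] -/
theorem stub_weightSummable : Summable weight := by
  refine summable_of_supNorm_bound (fun z => (weight_pos z).le) (a := fun m => ((1 + (m : ℝ)) ^ 5)⁻¹)
    weight_le_supNorm ?_
  -- the shell sums are dominated by `216 / (m+1)²`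
  have hg : Summable fun m : ℕ => (216 : ℝ) * (1 / ((m : ℝ) + 1) ^ 2) := by
    have h := (summable_nat_add_iff (f := fun n : ℕ => 1 / (n : ℝ) ^ 2) 1).2
      (Real.summable_one_div_nat_pow.2 one_lt_two)
    simpa [Nat.cast_add, Nat.cast_one] using h.mul_left 216
  refine Summable.of_nonneg_of_le (fun m => by positivity) (fun m => ?_) hg
  rcases m with _ | k
  · -- the origin shell: `#∂Λ_0 · 1 ≤ 216`
    have hcard : (#(sphere 4 0) : ℝ) ≤ 1 := by
      have h := Finset.card_le_card (sphere_subset_box 4 0)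
      rw [card_box] at h
      exact_mod_cast h
    simp only [Nat.cast_zero, add_zero, zero_add, one_pow, inv_one, mul_one, div_one]
    linarith [hcard]
  · have hcard := card_sphere_succ_le (d := 4) k
    have hk : (0 : ℝ) ≤ k := Nat.cast_nonneg k
    -- `2·4·(2k+3)³ ≤ 216 (k+2)³`
    have h3 : (2 * (4 : ℕ) * (2 * (k : ℝ) + 3) ^ (4 - 1) : ℝ) ≤ 216 * ((k : ℝ) + 2) ^ 3 := by
      norm_num
      nlinarith [sq_nonneg ((k : ℝ) + 2), sq_nonneg (2 * (k : ℝ) + 3)]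
    have hpow : ((1 + ((k + 1 : ℕ) : ℝ)) ^ 5)⁻¹ = (((k : ℝ) + 2) ^ 5)⁻¹ := by
      push_cast; ring_nf
    rw [hpow]
    have hk2 : (0 : ℝ) < (k : ℝ) + 2 := by positivity
    calc (#(sphere 4 (k + 1)) : ℝ) * (((k : ℝ) + 2) ^ 5)⁻¹
        ≤ 216 * ((k : ℝ) + 2) ^ 3 * (((k : ℝ) + 2) ^ 5)⁻¹ :=
          mul_le_mul_of_nonneg_right (hcard.trans h3) (by positivity)
      _ = 216 * (1 / ((k : ℝ) + 2) ^ 2) := by field_simp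
      _ ≤ 216 * (1 / (((k + 1 : ℕ) : ℝ) + 1) ^ 2) := by push_cast; ring_nf; exact le_rfl

end Summit.QuantumFields.YangMills.Theorems.U1DipoleHelicity
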